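import Mathlib
import Literature.NumberTheory.LFunctions.Zhang2022.SkeletonPropositions
import HarnessLib

/-!
# Zhang (2022), typed skeleton — (2.32)/(2.33) with the main-order constant as a parameter (RT-08 nodes)

Topic `Literature/NumberTheory/LFunctions/Zhang2022` (Landau–Siegel audit tree; verdict-neutral).
Y. Zhang, *Discrete mean estimates and the Landau–Siegel zero*, arXiv:2211.02515v1 (2022)
[Zhang2022LandauSiegel] — **an unrefereed manuscript under adjudication.** Statement-only companion of
`SkeletonMainOrderEndgame` (ZHANG-L RT-08, terminal hypothesis E-105 `MainOrderContradiction`): the two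
inequalities (2.32) `Ξ₁ < 0.001𝔞𝔓` and (2.33) `Ξ_J < 3000𝔞𝔓` of §2 p. 6 re-stated with the main-order
constant a PARAMETER (`q`, `c_J`) and the `o(𝔞𝔓)` made explicit: `∀ η > 0`, eventually under (A),
`Ξ₁ ≤ (q+η)𝔞𝔓` resp. `Ξ_J ≤ (c_J+η)𝔞𝔓`. CLAIM-shapes, STATED NOT ASSERTED; the endgame file proves
`Ineq232With c′ (𝔠₁ + k + 2(Re 𝔠₃ + 10⁻⁵))` from (8.23), (9.7)@k, (18.1)ᴿ WITHOUT any margin and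
`Ineq233With c′ (8800/π)` from the typed (18.3) bound. Nothing about Landau–Siegel zeros.

## References

* Y. Zhang, arXiv:2211.02515v1 (2022), §2 (2.32)–(2.33) p. 6, §18 p. 99–101.
  [cite: Zhang2022LandauSiegel, §2 (2.32)–(2.33)]
-/

noncomputable section

namespace Literature.NumberTheory.LFunctions.Zhang2022.Skeleton

/-! ## (2.32) and (2.33) with the main-order constant as a parameter -/

section Nodes

variable (c' : ℝ)

/-- **(2.32) at main order with constant `q`**: for every `η > 0`, eventually under (A),
`Ξ₁ ≤ (q + η)𝔞𝔓` (the printed (2.32) is the claim that this holds with some `q < 0.001`; §18 gives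
`q = 𝔠₁ + 𝔠₂ + 2Re 𝔠₃`). CLAIM-shape, stated not asserted. [cite: Zhang2022LandauSiegel, §2 (2.32)] -/
def Ineq232With (q : ℝ) : Prop :=
  ∀ η : ℝ, 0 < η → ForAllLarge fun D _ χ => AssumptionA D χ →
    xi1 c' χ ≤ (q + η) * frakA χ * frakP D

/-- **(2.33) at main order with constant `c_J`**: for every `η > 0`, eventually under (A),
`Ξ_J ≤ (c_J + η)𝔞𝔓` (printed: `c_J < 3000`; the typed (18.3) bound gives `8800/π`, §18's own
computation `C₂₃₃ ≈ 2546.85`). CLAIM-shape, stated not asserted. [cite: Zhang2022LandauSiegel, §2 (2.33)] -/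
def Ineq233With (cJ : ℝ) : Prop :=
  ∀ η : ℝ, 0 < η → ForAllLarge fun D _ χ => AssumptionA D χ →
    xiJ c' χ ≤ (cJ + η) * frakA χ * frakP D

end Nodes

end Literature.NumberTheory.LFunctions.Zhang2022.Skeleton
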